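import Mathlib
import Literature.Analysis.FluidPDE.LerayHopf
import HarnessLib

/-!
# Route RootDecompLitSlice — brick B2 of the aside D₁ `DarkBallSpreads`
  (stmt-NavierStokesRegularity-29566; stub `stub_darkBallSpreads` of crux D `NoDarkBall` 29563):
  **identification of the terminal slice — a weakly `L²`-continuous family converging locally
  uniformly on an open set has its terminal slice equal a.e. there to the uniform limit.**

In the census ledger (row E20) for D₁, B1 produces on the regular region `Ω = ℝ³ ∖ Σ_T` a smooth
continuation `w = lim_{t → T⁻} u(t, ·)` (locally uniform limit near regular points), and B2 must
identify the Clay slice `u T` (about which the maximal-smooth-solution predicate says nothing)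
with `w` a.e. on `Ω`. The only information on `u T` is the Leray–Hopf weak `L²`-continuity
`t ↦ ∫ ⟪u t, φ⟫` on `(0, T]` (field `IsLerayHopfOn.weak_continuous`). This file proves the
abstract identification: if every slice `u t`, `t ∈ [0,T]`, is in `L²`, `t ↦ ∫⟪u t, φ⟫` is
continuous on `(0, T]` for every `φ ∈ L²`, `u(t, ·) → w` locally uniformly on an open `V` as
`t → T⁻`, and `w` is continuous on `V`, then `u T = w` a.e. on `V` — by testing against
`g • eᵢ` with `g ∈ C_c^∞(V)` (dominated convergence along `𝓝[<] T` versus weak continuity, then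
`IsOpen.ae_eq_zero_of_integral_contDiff_smul_eq_zero` componentwise).

Main results:
* `ae_eq_restrict_of_weakContinuousOn_of_tendstoLocallyUniformlyOn` — the abstract brick;
* `IsLerayHopfOn.ae_eq_restrict_of_tendstoLocallyUniformlyOn` — the Leray–Hopf corollary
  (`E = ℝ³`), the form B1/B3 of the census assembly consume.

HONEST FRAMING: measure theory only; closes no item by itself; rung 0 — nothing here bears on NS
regularity. Lands `--supports stmt-NavierStokesRegularity-29566` (decomp-ns route-writer g15).
Sources: Galdi 2000, Lemma 2.2 (weak `L²` continuity of Leray–Hopf solutions); du Bois-Reymond.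
-/

set_option linter.dupNamespace false
set_option linter.style.longLine false

noncomputable section

open MeasureTheory Set Metric Filter Topology Function Module
open scoped ENNReal RealInnerProductSpace
open Literature.Analysis.FluidPDE

namespace Summit.NavierStokesRegularity.NavierStokesRegularity.Theorems

section SliceIdentification

/-- **Brick B2 (abstract slice identification).** Let `u : ℝ → ℝ³ → ℝ³` with `u t ∈ L²` for
`t ∈ [0, T]`, `T > 0`, weakly `L²`-continuous on `(0, T]` (`t ↦ ∫ ⟪u t, φ⟫` continuous on
`Ioc 0 T` for every `φ ∈ L²`). If `u(t, ·) → w` locally uniformly on an open set `V` as `t → T⁻`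
and `w` is continuous on `V`, then `u T = w` a.e. on `V`. [cite: Galdi2000, Lemma 2.2] -/
theorem ae_eq_restrict_of_weakContinuousOn_of_tendstoLocallyUniformlyOn
    {u : ℝ → EuclideanSpace ℝ (Fin 3) → EuclideanSpace ℝ (Fin 3)} {T : ℝ} (hT : 0 < T)
    (hmem : ∀ t ∈ Icc 0 T, MemLp (u t) 2 volume)
    (hweak : ∀ φ : EuclideanSpace ℝ (Fin 3) → EuclideanSpace ℝ (Fin 3), MemLp φ 2 volume →
      ContinuousOn (fun t => ∫ x, ⟪u t x, φ x⟫) (Ioc 0 T))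
    {V : Set (EuclideanSpace ℝ (Fin 3))} (hV : IsOpen V)
    {w : EuclideanSpace ℝ (Fin 3) → EuclideanSpace ℝ (Fin 3)} (hw : ContinuousOn w V)
    (hconv : TendstoLocallyUniformlyOn (fun t x => u t x) w (𝓝[<] T) V) :
    ∀ᵐ x ∂(volume.restrict V), u T x = w x := by
  -- component continuity
  have hci : ∀ i : Fin 3, Continuous fun v : EuclideanSpace ℝ (Fin 3) => v i := fun i => by
    fun_prop
  -- componentwise statement on `V`
  suffices hcomp : ∀ i : Fin 3, ∀ᵐ x ∂(volume : Measure (EuclideanSpace ℝ (Fin 3))),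
      x ∈ V → (u T x - w x) i = 0 by
    rw [ae_restrict_iff' hV.measurableSet]
    have hall : ∀ᵐ x ∂(volume : Measure (EuclideanSpace ℝ (Fin 3))), ∀ i : Fin 3,
        x ∈ V → (u T x - w x) i = 0 := ae_all_iff.2 hcomp
    filter_upwards [hall] with x hx hxV
    have : u T x - w x = 0 := by
      ext i
      simpa using hx i hxV
    exact sub_eq_zero.1 this
  intro i
  -- local integrability of the `i`-th component of `u T - w` on `V`
  have hLI : LocallyIntegrableOn (fun x => (u T x - w x) i) V volume := by
    have h1 : LocallyIntegrableOn (fun x => (u T x) i) V volume := by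
      have hint : LocallyIntegrable (u T) volume :=
        (hmem T ⟨hT.le, le_rfl⟩).locallyIntegrable (by norm_num)
      refine (hint.locallyIntegrableOn V).mono
        ((hci i).comp_aestronglyMeasurable (hmem T ⟨hT.le, le_rfl⟩).1) (Eventually.of_forall ?_)
      intro x
      simpa using PiLp.norm_apply_le (u T x) i
    have h2 : LocallyIntegrableOn (fun x => (w x) i) V volume :=
      ((hci i).comp_continuousOn hw).locallyIntegrableOn hV.measurableSet
    have h3 : LocallyIntegrableOn (fun x => (u T x) i - (w x) i) V volume := h1.sub h2
    simpa using h3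
  -- the test: for `g ∈ C_c^∞(V)`, `∫ g • (u T - w)ᵢ = 0`
  refine hV.ae_eq_zero_of_integral_contDiff_smul_eq_zero hLI fun g hg hgsupp hgV => ?_
  have hgc : Continuous g := hg.continuous
  set K : Set (EuclideanSpace ℝ (Fin 3)) := tsupport g with hK_def
  have hK : IsCompact K := hgsupp
  -- (a) `∫ g · (u t)ᵢ → ∫ g · wᵢ` as `t → T⁻` (dominated convergence under uniform convergence on `K`)
  have hunif : TendstoUniformlyOn (fun t x => u t x) w (𝓝[<] T) K :=
    (tendstoLocallyUniformlyOn_iff_forall_isCompact hV).1 hconv K hgV hK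
  obtain ⟨B, hB⟩ := hK.exists_bound_of_continuousOn (hw.mono hgV)
  have hlimA : Tendsto (fun t => ∫ x, g x * (u t x) i) (𝓝[<] T) (𝓝 (∫ x, g x * (w x) i)) := by
    refine tendsto_integral_filter_of_dominated_convergence (fun x => ‖g x‖ * (B + 1)) ?_ ?_ ?_ ?_
    · -- measurability, for `t ∈ (0, T)`
      filter_upwards [Ioo_mem_nhdsLT hT] with t ht
      exact (hgc.aestronglyMeasurable).mul
        ((hci i).comp_aestronglyMeasurable (hmem t ⟨ht.1.le, ht.2.le⟩).1)
    · -- domination, for `t` close to `T` (uniformly `dist (w x) (u t x) < 1` on `K`)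
      filter_upwards [Metric.tendstoUniformlyOn_iff.1 hunif 1 one_pos] with t ht
      refine Eventually.of_forall fun x => ?_
      by_cases hx : x ∈ K
      · have hd : dist (w x) (u t x) < 1 := ht x hx
        have hux : ‖u t x‖ ≤ B + 1 := by
          calc ‖u t x‖ = ‖w x - (w x - u t x)‖ := by rw [sub_sub_cancel]
            _ ≤ ‖w x‖ + ‖w x - u t x‖ := norm_sub_le _ _
            _ ≤ B + 1 := add_le_add (hB x hx) (by rw [← dist_eq_norm]; exact hd.le)
        rw [norm_mul]
        gcongr
        exact (PiLp.norm_apply_le (u t x) i).trans hux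
      · have hgx : g x = 0 := image_eq_zero_of_notMem_tsupport hx
        simp [hgx]
    · exact (hgc.norm.mul continuous_const).integrable_of_hasCompactSupport
        (hgsupp.norm.mul_right)
    · refine Eventually.of_forall fun x => ?_
      by_cases hx : x ∈ K
      · exact ((hci i).tendsto _ |>.comp (hunif.tendsto_at hx)).const_mul (g x)
      · have hgx : g x = 0 := image_eq_zero_of_notMem_tsupport hx
        simp [hgx]
  -- (b) `∫ g · (u t)ᵢ → ∫ g · (u T)ᵢ` as `t → T⁻` (weak `L²` continuity tested on `g • eᵢ`)
  set φ : EuclideanSpace ℝ (Fin 3) → EuclideanSpace ℝ (Fin 3) :=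
    fun x => g x • EuclideanSpace.single i (1 : ℝ) with hφ_def
  have hφmem : MemLp φ 2 volume :=
    (hgc.smul continuous_const).memLp_of_hasCompactSupport hgsupp.smul_right
  have hinner : ∀ (v : EuclideanSpace ℝ (Fin 3)) (r : ℝ),
      ⟪v, r • EuclideanSpace.single i (1 : ℝ)⟫ = r * v i := fun v r => by
    rw [real_inner_smul_right, EuclideanSpace.inner_single_right]
    simp
  have hφint : ∀ t, (∫ x, ⟪u t x, φ x⟫) = ∫ x, g x * (u t x) i := fun t => by
    simp only [hφ_def, hinner]
  have hlimB : Tendsto (fun t => ∫ x, g x * (u t x) i) (𝓝[<] T) (𝓝 (∫ x, g x * (u T x) i)) := by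
    have hcw := (hweak φ hφmem T ⟨hT, le_rfl⟩).tendsto
    rw [← nhdsWithin_Ioo_eq_nhdsLT hT]
    simpa only [hφint] using hcw.mono_left (nhdsWithin_mono _ Ioo_subset_Ioc_self)
  -- uniqueness of limits and the conclusion
  haveI : (𝓝[<] T).NeBot := nhdsLT_neBot T
  have heq : (∫ x, g x * (u T x) i) = ∫ x, g x * (w x) i := tendsto_nhds_unique hlimB hlimA
  -- `∫ g • (u T - w)ᵢ = ∫ g (u T)ᵢ - ∫ g wᵢ = 0`
  have hint1 : Integrable (fun x => g x * (u T x) i) volume := by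
    have hli : LocallyIntegrable (fun x => (u T x) i) volume :=
      ((hmem T ⟨hT.le, le_rfl⟩).locallyIntegrable (by norm_num)).mono
        ((hci i).comp_aestronglyMeasurable (hmem T ⟨hT.le, le_rfl⟩).1)
        (Eventually.of_forall fun x => by simpa using PiLp.norm_apply_le (u T x) i)
    exact hli.integrable_smul_left_of_hasCompactSupport hgc hgsupp
  have hint2 : Integrable (fun x => g x * (w x) i) volume := by
    -- `g · wᵢ` is continuous with compact support (`w` continuous on `V ⊇ tsupport g`)
    have hcont : Continuous fun x => g x * (w x) i := by
      refine continuous_iff_continuousAt.2 fun x => ?_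
      by_cases hx : x ∈ V
      · exact (hgc.continuousAt).mul
          (((hci i).comp_continuousOn hw).continuousAt (hV.mem_nhds hx))
      · have hx' : x ∉ tsupport g := fun h => hx (hgV h)
        have hev : (fun y => g y * (w y) i) =ᶠ[𝓝 x] fun _ => 0 := by
          filter_upwards [notMem_tsupport_iff_eventuallyEq.1 hx'] with y hy
          simp [hy]
        exact (continuousAt_const.congr hev.symm)
    exact hcont.integrable_of_hasCompactSupport hgsupp.mul_right
  have : (∫ x, g x • (u T x - w x) i) = (∫ x, g x * (u T x) i) - ∫ x, g x * (w x) i := by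
    rw [← integral_sub hint1 hint2]
    refine integral_congr_ae (Eventually.of_forall fun x => ?_)
    simp [mul_sub]
  rw [this, heq, sub_self]

/-- **Brick B2 for Leray–Hopf solutions on `ℝ³ × [0, T)`.** If `u` is Leray–Hopf on `[0, T)`
(any force and datum) and `u(t, ·) → w` locally uniformly on an open set `V` as `t → T⁻`, with
`w` continuous on `V`, then the terminal slice satisfies `u T = w` a.e. on `V` (the slices are in
`L²` on `[0, T]` and weakly `L²`-continuous on `(0, T]` by the fields `memLp`, `weak_continuous`).
[cite: Galdi2000, Lemma 2.2] -/
theorem lerayHopf_ae_eq_restrict_of_tendstoLocallyUniformlyOn {T ν : ℝ}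
    {f : ℝ → EuclideanSpace ℝ (Fin 3) → EuclideanSpace ℝ (Fin 3)}
    {u₀ : EuclideanSpace ℝ (Fin 3) → EuclideanSpace ℝ (Fin 3)}
    {u : ℝ → EuclideanSpace ℝ (Fin 3) → EuclideanSpace ℝ (Fin 3)} (hT : 0 < T)
    (hLH : IsLerayHopfOn T ν f u₀ u) {V : Set (EuclideanSpace ℝ (Fin 3))} (hV : IsOpen V)
    {w : EuclideanSpace ℝ (Fin 3) → EuclideanSpace ℝ (Fin 3)} (hw : ContinuousOn w V)
    (hconv : TendstoLocallyUniformlyOn (fun t x => u t x) w (𝓝[<] T) V) :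
    ∀ᵐ x ∂(volume.restrict V), u T x = w x :=
  ae_eq_restrict_of_weakContinuousOn_of_tendstoLocallyUniformlyOn hT hLH.memLp
    (fun φ hφ => (hLH.weak_continuous φ hφ).1) hV hw hconv

/-- **Brick B2, dark-ball reading.** Under the hypotheses of
`lerayHopf_ae_eq_restrict_of_tendstoLocallyUniformlyOn`, if moreover `u T = 0` a.e. on a ball
`B(x₀, ρ)`, then the local uniform limit `w` vanishes identically on `B(x₀, ρ) ∩ V` (continuous and
a.e. zero on an open set). [folklore] -/
theorem lerayHopf_limit_eqOn_zero_of_darkBall {T ν : ℝ}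
    {f : ℝ → EuclideanSpace ℝ (Fin 3) → EuclideanSpace ℝ (Fin 3)}
    {u₀ : EuclideanSpace ℝ (Fin 3) → EuclideanSpace ℝ (Fin 3)}
    {u : ℝ → EuclideanSpace ℝ (Fin 3) → EuclideanSpace ℝ (Fin 3)} (hT : 0 < T)
    (hLH : IsLerayHopfOn T ν f u₀ u) {V : Set (EuclideanSpace ℝ (Fin 3))} (hV : IsOpen V)
    {w : EuclideanSpace ℝ (Fin 3) → EuclideanSpace ℝ (Fin 3)} (hw : ContinuousOn w V)
    (hconv : TendstoLocallyUniformlyOn (fun t x => u t x) w (𝓝[<] T) V)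
    {x₀ : EuclideanSpace ℝ (Fin 3)} {ρ : ℝ}
    (hdark : ∀ᵐ x ∂(volume.restrict (ball x₀ ρ)), u T x = 0) :
    EqOn w 0 (ball x₀ ρ ∩ V) := by
  have h1 : ∀ᵐ x ∂(volume.restrict (ball x₀ ρ ∩ V)), u T x = w x :=
    ae_restrict_of_ae_restrict_of_subset inter_subset_right
      (lerayHopf_ae_eq_restrict_of_tendstoLocallyUniformlyOn hT hLH hV hw hconv)
  have h2 : ∀ᵐ x ∂(volume.restrict (ball x₀ ρ ∩ V)), u T x = 0 :=
    ae_restrict_of_ae_restrict_of_subset inter_subset_left hdark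
  have h3 : ∀ᵐ x ∂(volume.restrict (ball x₀ ρ ∩ V)),
      w x = (0 : EuclideanSpace ℝ (Fin 3) → EuclideanSpace ℝ (Fin 3)) x := by
    filter_upwards [h1, h2] with x hx1 hx2
    rw [← hx1, hx2, Pi.zero_apply]
  exact Measure.eqOn_open_of_ae_eq h3 (isOpen_ball.inter hV) (hw.mono inter_subset_right)
    continuousOn_const

end SliceIdentification

end Summit.NavierStokesRegularity.NavierStokesRegularity.Theorems
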